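import Summits.BirchSwinnertonDyer.BirchSwinnertonDyer.Theses.LeadingTerm
import Literature.NumberTheory.EllipticCurves.BSDInvariants
import Literature.NumberTheory.EllipticCurves.PAdicHeights
import Literature.NumberTheory.EllipticCurves.NonvanishingTwists

/-!
# Line `Rung_mult3_r1` — forward rung R5 (`g1-BSD-rank1-R5`) on crux `LeadingTerm.KatoDivisibility`

FORWARD GENERATOR G1 (next-rung), unit `fwd-rung-BirchSwinnertonDyer-01`, parent route
`route-BirchSwinnertonDyer-LeadingTerm` (rev 11).  HOST: `KatoDivisibility`
(stmt-BirchSwinnertonDyer-18082) is the NEAREST crux of the parent route, and this rung lies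
OUTSIDE its cone: `KatoDivisibility` is Kato's cyclotomic divisibility at GOOD ordinary `p`
(`IsOrdinaryAt`), while the rung is the `p`-part of the rank-one leading-term formula at a
MULTIPLICATIVE `p = 3`; they meet only in the method family (cyclotomic/anticyclotomic main
conjectures; the rung's rank-0 input `stub_twistZero` is the `p ‖ N` extension of Kato–Skinner–Urban).
The rung advances the bsd-rank1 cell's ladder `BSD_{≤1}` (RUNGS.md R5), not the rank statement
`BirchSwinnertonDyer`; no route, no `closes` (brief F2).

* FAMILY  `RungMultR1 p₀` — Castella's corrected theorem for every multiplicative prime `p ≥ p₀`.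
* FLOOR   `RungMultR1 5` = `castella_thmA'` (Castella, Erratum to CJM 6 (2018) 1–23, Thm. A′ —
          NOT the uncorrected Thm. A of the brief's FLOOR.md: Cas18 Thm. 4.2 fails, semistability is
          dropped, nonsplit-`q` and `E(ℚ_p)[p] = 0` are added).
* RUNG    `Rung_mult3_r1 := RungMultR1 3` (one move: threshold `p₀ : 5 ↦ 3`).
* PRIOR ART at this cell (both `p ≥ 5`): Castella A′ (Hida-family IMC + `p ‖ N` BDP formula) and
          Skinner–Zhang, arXiv:1407.1099, Thm. 1.2 (indivisibility of Heegner points mod `p`,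
          hypotheses (a)–(e): `p ∤ ord_p Δ`, 𝓛-invariant condition, ramification at `ℓ ≡ ±1 (p)`,
          two ramified `ℓ ‖ N`; "p ≥ 5" throughout, p. 5).  The only printed `p = 3` leading-term
          results near the cell are at EISENSTEIN `3` (Kriz–Li, arXiv:1609.06687, Thm. 1.14: CM
          sextic twists, `E[3]` reducible, additive at `3`) — disjoint from the rung's (irr)+mult.
* SKELETON (Castella §5 architecture over an auxiliary imaginary quadratic `K`, phrased over `ℚ`
  through a globally minimal model `W'` of the twist `E^{d_K}`):
  `stub_auxField` (Friedberg–Hoffstein choice of `K`, printed) →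
  `stub_KPackage` (GZ–Kolyvagin–IMC–BDP package over `K`: the sum of the `p`-adic BSD defects of
  `E` and `E^{d_K}` vanishes — OPEN at `p = 3`, the load-bearing stub) →
  `stub_twistZero` (rank-0 `p`-part for the twist, Skinner 2016 Thm. C / JSW Thm. 7.2.1(ii),
  printed for `p ≥ 3`) → `Rung_mult3_r1_of` (kernel-checked, arithmetic only).
-/

noncomputable section

open scoped Classical

namespace Summit.BirchSwinnertonDyer.BirchSwinnertonDyer.Cruxes.KatoDivisibility.RungMult3R1

open WeierstrassCurve Literature.NumberTheory.EllipticCurves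

/-! ### The rung (defs identical to the planner's `Sketch.lean`) -/

/-- The `p`-part of the BSD leading-term formula for `W` (verbatim copy of `BSDRankOneCell.PPart`
from the bsd-rank1 brief cell). -/
def PPart (W : WeierstrassCurve ℚ) [W.IsElliptic] (p : ℕ) [Fact p.Prime] : Prop :=
  ∃ q : ℚ, W.leadingLCoeff / ((W.realPeriodRat * W.regulator : ℝ) : ℂ) = (q : ℂ) ∧
    padicValRat p q = (padicValNat p W.shaOrder : ℤ) + padicValNat p W.tamagawaProduct -
      2 * padicValNat p W.torsionOrder

/-- The algebraic side of `PPart` as an integer: `v_p(#Ш) + v_p(∏ c_ℓ) - 2 v_p(#tors)`. -/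
def algSide (W : WeierstrassCurve ℚ) (p : ℕ) : ℤ :=
  (padicValNat p W.shaOrder : ℤ) + padicValNat p W.tamagawaProduct - 2 * padicValNat p W.torsionOrder

/-- GRADED FAMILY (parameter = prime threshold `p₀`): the corrected Castella theorem for every
multiplicative prime `p ≥ p₀` (hypotheses of Erratum Thm. A′, transcribed as in bsd.S30). -/
def RungMultR1 (p₀ : ℕ) : Prop :=
  ∀ (W : WeierstrassCurve ℚ) [W.IsElliptic] [W.IsGloballyMinimal] (p : ℕ) [Fact p.Prime],
    p₀ ≤ p → W.analyticRank = 1 → W.HasMultiplicativeReductionAtPrime p →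
    W.HasIrreducibleModPGaloisRep p →
    (∃ (q : ℕ) (_ : Fact q.Prime), q ≠ p ∧ W.HasMultiplicativeReductionAtPrime q ∧
      ¬ W.HasSplitMultiplicativeReductionAtPrime q ∧ ¬ p ∣ padicValInt q W.minimalDiscriminantInt) →
    (∀ P : (W.baseChange ℚ_[p]).toAffine.Point, p • P = 0 → P = 0) →
    PPart W p

/-- FLOOR (named fact). **Castella, Erratum to "On the p-part of the Birch–Swinnerton-Dyer formula
for multiplicative primes", Thm. A′** (replaces Camb. J. Math. 6 (2018), Thm. A for `p ‖ N`):
multiplicative reduction at `p > 3`, `E[p]` irreducible, nonsplit multiplicative reduction at some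
`q ≠ p` where `E[p]` is ramified, `E(ℚ_p)[p] = 0`, `ord_{s=1} L(E,s) = 1` ⟹
`ord_p (L'(E,1)/(Reg·Ω_E)) = ord_p (#Ш(E/ℚ) ∏_{ℓ∣N} c_ℓ)`.
[cite: paper:url-e83251f1873d, Thm. A′] [cite: doi:10.4310/CJM.2018.v6.n1.a1, Thm. A] -/
def castella_thmA' : Prop :=
  ∀ (W : WeierstrassCurve ℚ) [W.IsElliptic] [W.IsGloballyMinimal] (p : ℕ) [Fact p.Prime],
    5 ≤ p → W.analyticRank = 1 → W.HasMultiplicativeReductionAtPrime p →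
    W.HasIrreducibleModPGaloisRep p →
    (∃ (q : ℕ) (_ : Fact q.Prime), q ≠ p ∧ W.HasMultiplicativeReductionAtPrime q ∧
      ¬ W.HasSplitMultiplicativeReductionAtPrime q ∧ ¬ p ∣ padicValInt q W.minimalDiscriminantInt) →
    (∀ P : (W.baseChange ℚ_[p]).toAffine.Point, p • P = 0 → P = 0) →
    PPart W p

/-- RUNG R5 (`Rung_mult3_r1`): the threshold lowered to `p ≥ 3`, i.e. FLOOR ∧ (the bsd-rank1 cell
`p = 3`, multiplicative, `r_an = 1`). -/
def Rung_mult3_r1 : Prop := RungMultR1 3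

/-- F1/F3: the floor is LITERALLY the specialisation `p₀ = 5` of the family. -/
theorem floor_is_specialisation (h : castella_thmA') : RungMultR1 5 := by
  simpa [RungMultR1, castella_thmA'] using h

/-- The family is monotone in the threshold, so RUNG → FLOOR by specialisation. -/
theorem rungMultR1_mono {a b : ℕ} (hab : a ≤ b) (h : RungMultR1 a) : RungMultR1 b :=
  fun W _ _ p _ hp => h W p (hab.trans hp)

theorem floor_of_rung (h : Rung_mult3_r1) : RungMultR1 5 := rungMultR1_mono (by norm_num) h

/-! ### Auxiliary field (Castella §5): `K` imaginary quadratic, `q` ramified, every other prime of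
the conductor split (`SatisfiesHeegnerHypothesis (N/q) K`; `q ‖ N` as `q` is multiplicative), and a
globally minimal model `W'` of the twist `E^{d_K}` with `L(E^{d_K}, 1) ≠ 0`. -/

/-- Castella's admissibility conditions on `(W, q, K, W')`. -/
def IsCastellaField (W : WeierstrassCurve ℚ) (q : ℕ) (K : Type) [Field K] [NumberField K]
    (W' : WeierstrassCurve ℚ) : Prop :=
  IsImaginaryQuadratic K ∧ (q : ℤ) ∣ NumberField.discr K ∧
    SatisfiesHeegnerHypothesis (W.conductorNorm ℤ / q) K ∧
    (∃ C : VariableChange ℚ, C • W.quadraticTwist (NumberField.discr K : ℚ) = W') ∧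
    W'.analyticRank = 0

/-! ### Registered stubs -/

/-- STUB 1 (`stub_auxField`, size S, PRINTED): for `E` of analytic rank one, multiplicative at `p`,
with a nonsplit multiplicative prime `q ≠ p`, there is an imaginary quadratic `K` with `q`
ramified, every other prime of `N` split, and `L(E^{d_K},1) ≠ 0`, together with a globally
minimal model `W'` of `E^{d_K}` of analytic rank `0`.  Root numbers: `w(E) = -1` (odd order),
`w(E/K) = -1`, so `w(E^{d_K}) = +1`; nonvanishing for infinitely many such `d_K` with the finitely
many local conditions: Friedberg–Hoffstein, Ann. of Math. 142 (1995), Thm. B (as used in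
[JSW, §7.4.1] and [Cas18, §5]); minimal model: `GlobalMinimalModel`. -/
theorem stub_auxField :
    ∀ (W : WeierstrassCurve ℚ) [W.IsElliptic] [W.IsGloballyMinimal] (p q : ℕ) [Fact p.Prime]
      [Fact q.Prime], 3 ≤ p → W.analyticRank = 1 → W.HasMultiplicativeReductionAtPrime p →
      q ≠ p → W.HasMultiplicativeReductionAtPrime q → ¬ W.HasSplitMultiplicativeReductionAtPrime q →
      ∃ (K : Type) (_ : Field K) (_ : NumberField K) (W' : WeierstrassCurve ℚ)
        (_ : W'.IsElliptic) (_ : W'.IsGloballyMinimal), IsCastellaField W q K W' := by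
  sorry

/-- STUB 2 (`stub_KPackage`, size L, OPEN at `p = 3` — the load-bearing stub): the Iwasawa–Heegner
package over Castella's field `K`.  For `(W, p, q, K, W')` as above with `E[p]` irreducible,
`E[p]` ramified at `q`, `E(ℚ_p)[p] = 0`: the analytic sides of BSD for `E` (rank 1) and for
`E^{d_K}` (rank 0) are rational and the SUM of their `p`-adic valuations equals the sum of the
algebraic sides.  Printed chain for `p ≥ 5` (Castella §5 with the Erratum): anticyclotomic IMC
`Ch_Λ(X_ac) Λ_{R₀} = (L_p(f))` (Erratum Thm. 1.1: two-variable big-Heegner-point IMC in the Hida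
family + `p ‖ N` explicit reciprocity law), BDP/`p`-adic Waldspurger value
`L_p(f,1) = (1 - a_p p^{-1}) log_ω(P_K))²` for `p ‖ N` (cas-split Thm. 2.11), anticyclotomic control
theorem (JSW Thm. 3.3.1, algebra valid for `p > 2`), Gross–Zagier paraphrase
`L'(E,1)L(E^D,1)/(Ω_E Reg Ω_{E^D}) ≐ [E(K):ℤP_K]²`, Skinner–Zhang period/Tamagawa relations and
`Ш(E/K)[p^∞] = Ш(E)[p^∞] ⊕ Ш(E^D)[p^∞]` (`p` odd).  At `p = 3` every Hida-theoretic input is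
printed only for `p ≥ 5` (Howard's big Heegner points `p ∤ 6N`; ordinary locus via `E_{p-1}`);
BCS24 (arXiv:2405.00270, p. 5) isolate the one essential use of `p > 3` in the good-ordinary
analogue (a period comparison in Wan's divisibility) — whether the `p ‖ N` chain has a further
essential use of `p ≥ 5` is exactly what this stub decides. -/
theorem stub_KPackage :
    ∀ (W : WeierstrassCurve ℚ) [W.IsElliptic] [W.IsGloballyMinimal] (p q : ℕ) [Fact p.Prime]
      [Fact q.Prime] (K : Type) [Field K] [NumberField K] (W' : WeierstrassCurve ℚ) [W'.IsElliptic]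
      [W'.IsGloballyMinimal], 3 ≤ p → W.analyticRank = 1 → W.HasMultiplicativeReductionAtPrime p →
      W.HasIrreducibleModPGaloisRep p → q ≠ p → W.HasMultiplicativeReductionAtPrime q →
      ¬ W.HasSplitMultiplicativeReductionAtPrime q → ¬ p ∣ padicValInt q W.minimalDiscriminantInt →
      (∀ P : (W.baseChange ℚ_[p]).toAffine.Point, p • P = 0 → P = 0) →
      IsCastellaField W q K W' →
      ∃ q₁ q₂ : ℚ, W.leadingLCoeff / ((W.realPeriodRat * W.regulator : ℝ) : ℂ) = (q₁ : ℂ) ∧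
        W'.leadingLCoeff / ((W'.realPeriodRat * W'.regulator : ℝ) : ℂ) = (q₂ : ℂ) ∧
        padicValRat p q₁ + padicValRat p q₂ = algSide W p + algSide W' p := by
  sorry

/-- STUB 3 (`stub_twistZero`, size M, PRINTED for `p ≥ 3` modulo a hypothesis check): the rank-0
`p`-part of BSD for the twist `E^{d_K}` (`W'` its globally minimal model): `E^{d_K}` is
multiplicative at `p` (`p` splits in `K`), `E^{d_K}[p] ≅ E[p] ⊗ χ_K` is irreducible and ramified
at `q`, `L(E^{d_K},1) ≠ 0` ⟹ `v_p(L(E^{d_K},1)/Ω) = v_p(#Ш ∏ c_ℓ)` (no `p`-torsion).  Sources: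
Skinner, Pacific J. Math. 283 (2016), Thm. C (`p ≥ 3`, multiplicative `p`; arXiv:1407.1093 p. 3);
JSW, Camb. J. Math. 5 (2017), Thm. 7.2.1(ii) ("a prime `q` of multiplicative reduction for `E` at
which `ρ̄_{𝓔,p}` is ramified"), Kato's divisibility extended to `p ‖ N` (Skinner 2016 §3).  CHECK:
`E^{d_K}` has ADDITIVE reduction at the ramified `q`, so Skinner–Urban's literal `q ‖ N_{E^D}` is not
met by `q` itself; the floor (Castella A′, `p ≥ 5`) invokes the identical input, so this is a
floor-level check, not a `p = 3` phenomenon. -/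
theorem stub_twistZero :
    ∀ (W : WeierstrassCurve ℚ) [W.IsElliptic] [W.IsGloballyMinimal] (p q : ℕ) [Fact p.Prime]
      [Fact q.Prime] (K : Type) [Field K] [NumberField K] (W' : WeierstrassCurve ℚ) [W'.IsElliptic]
      [W'.IsGloballyMinimal], 3 ≤ p → W.analyticRank = 1 → W.HasMultiplicativeReductionAtPrime p →
      W.HasIrreducibleModPGaloisRep p → q ≠ p → W.HasMultiplicativeReductionAtPrime q →
      ¬ W.HasSplitMultiplicativeReductionAtPrime q → ¬ p ∣ padicValInt q W.minimalDiscriminantInt →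
      IsCastellaField W q K W' → PPart W' p := by
  sorry

/-! ### Kernel-checked composition -/

/-- `Rung_mult3_r1_of`: the three stubs imply the rung (pure bookkeeping: choose `K, W'` by
STUB 1, subtract the rank-0 identity of STUB 3 from the two-curve identity of STUB 2). -/
theorem Rung_mult3_r1_of
    (h₁ : ∀ (W : WeierstrassCurve ℚ) [W.IsElliptic] [W.IsGloballyMinimal] (p q : ℕ) [Fact p.Prime]
      [Fact q.Prime], 3 ≤ p → W.analyticRank = 1 → W.HasMultiplicativeReductionAtPrime p →
      q ≠ p → W.HasMultiplicativeReductionAtPrime q → ¬ W.HasSplitMultiplicativeReductionAtPrime q →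
      ∃ (K : Type) (_ : Field K) (_ : NumberField K) (W' : WeierstrassCurve ℚ)
        (_ : W'.IsElliptic) (_ : W'.IsGloballyMinimal), IsCastellaField W q K W')
    (h₂ : ∀ (W : WeierstrassCurve ℚ) [W.IsElliptic] [W.IsGloballyMinimal] (p q : ℕ) [Fact p.Prime]
      [Fact q.Prime] (K : Type) [Field K] [NumberField K] (W' : WeierstrassCurve ℚ) [W'.IsElliptic]
      [W'.IsGloballyMinimal], 3 ≤ p → W.analyticRank = 1 → W.HasMultiplicativeReductionAtPrime p →
      W.HasIrreducibleModPGaloisRep p → q ≠ p → W.HasMultiplicativeReductionAtPrime q →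
      ¬ W.HasSplitMultiplicativeReductionAtPrime q → ¬ p ∣ padicValInt q W.minimalDiscriminantInt →
      (∀ P : (W.baseChange ℚ_[p]).toAffine.Point, p • P = 0 → P = 0) →
      IsCastellaField W q K W' →
      ∃ q₁ q₂ : ℚ, W.leadingLCoeff / ((W.realPeriodRat * W.regulator : ℝ) : ℂ) = (q₁ : ℂ) ∧
        W'.leadingLCoeff / ((W'.realPeriodRat * W'.regulator : ℝ) : ℂ) = (q₂ : ℂ) ∧
        padicValRat p q₁ + padicValRat p q₂ = algSide W p + algSide W' p)
    (h₃ : ∀ (W : WeierstrassCurve ℚ) [W.IsElliptic] [W.IsGloballyMinimal] (p q : ℕ) [Fact p.Prime]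
      [Fact q.Prime] (K : Type) [Field K] [NumberField K] (W' : WeierstrassCurve ℚ) [W'.IsElliptic]
      [W'.IsGloballyMinimal], 3 ≤ p → W.analyticRank = 1 → W.HasMultiplicativeReductionAtPrime p →
      W.HasIrreducibleModPGaloisRep p → q ≠ p → W.HasMultiplicativeReductionAtPrime q →
      ¬ W.HasSplitMultiplicativeReductionAtPrime q → ¬ p ∣ padicValInt q W.minimalDiscriminantInt →
      IsCastellaField W q K W' → PPart W' p) :
    Rung_mult3_r1 := by
  intro W _ _ p _ hp hr hmult hirr haux htors
  obtain ⟨q, hqFact, hqp, hmq, hnsq, hram⟩ := haux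
  obtain ⟨K, hK₁, hK₂, W', hW'₁, hW'₂, hadm⟩ := h₁ W p q hp hr hmult hqp hmq hnsq
  obtain ⟨q₁, q₂, hq₁, hq₂, hsum⟩ := h₂ W p q K W' hp hr hmult hirr hqp hmq hnsq hram htors hadm
  obtain ⟨q₃, hq₃, hval₃⟩ := h₃ W p q K W' hp hr hmult hirr hqp hmq hnsq hram hadm
  have h23 : q₂ = q₃ := by
    have : ((q₂ : ℚ) : ℂ) = ((q₃ : ℚ) : ℂ) := hq₂.symm.trans hq₃
    exact_mod_cast this
  subst h23
  refine ⟨q₁, hq₁, ?_⟩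
  have hval₂ : padicValRat p q₂ = algSide W' p := by simpa [algSide] using hval₃
  have : padicValRat p q₁ = algSide W p := by linarith
  simpa [algSide] using this

end Summit.BirchSwinnertonDyer.BirchSwinnertonDyer.Cruxes.KatoDivisibility.RungMult3R1
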